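import Literature.Probability.LatticeModels.LatticeGreenPoisson
import Literature.Probability.LatticeModels.LatticeDirichletEnergy

/-!
# The lattice Green function of `ℤ^d` (`d ≥ 3`) is strictly positive

Topic `Literature/Probability/LatticeModels`; companion of `LatticeGreenPoisson.lean` (`Δ latticeGreen = -2δ₀`,
superharmonicity) and `LatticeDirichletEnergy.lean` (`latticeGreen_nonneg`, by the minimum principle at infinity).
Everything here is PROVED; no named fact is introduced.

* `latticeGreen_eq_zero_propagate` — strong minimum principle along coordinate steps: a zero of the nonnegative
  superharmonic function `latticeGreen` forces zeros at all `2d` neighbours (`eq_of_latticeLaplacianZd_nonneg`), hence,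
  by induction on the `ℓ¹` norm, at the origin;
* **`latticeGreen_pos`** — `latticeGreen x > 0` for every `x ∈ ℤ^d`, `d ≥ 3` (a zero at the origin contradicts
  `Δ latticeGreen (0) = -2 < 0` and `latticeGreen ≥ 0`).  In random-walk language (`latticeGreen = d⁻¹ ∑ₙ P(Sₙ = x)`)
  this is irreducibility of the simple random walk (Lawler 1991, §1.5); here it is derived from the Fourier-side
  definition through the Poisson equation and the maximum principle only.

## References
* G. F. Lawler, *Intersections of Random Walks* (1991), §1.5 [Lawler1991].
-/

noncomputable section

namespace Literature.Probability.LatticeModels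

open Finset

variable {d : ℕ}

variable (d) in
/-- **Strong minimum principle, propagated to the origin.** If `latticeGreen x = 0` for some `x` with `‖x‖₁ = n`
then `latticeGreen 0 = 0` (`d ≥ 3`): `-latticeGreen` is subharmonic (`Δ latticeGreen ≤ 0`), `≤ 0`, and attains its
maximum `0` at `x`, so it vanishes at the neighbours `x ± eᵢ` (`eq_of_latticeLaplacianZd_nonneg`); step towards `0`
along a nonzero coordinate and induct on `‖x‖₁`. [cite: Lawler1991, §1.5] -/
theorem latticeGreen_eq_zero_propagate (hd : 3 ≤ d) :
    ∀ n : ℕ, ∀ x : Site d, (∑ i, (x i).natAbs) = n → latticeGreen x = 0 → latticeGreen (0 : Site d) = 0 := by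
  have hG := fun z => latticeGreen_nonneg d hd z
  intro n
  induction n with
  | zero =>
    intro x hx h0
    have : x = 0 := by
      funext i
      have := (Finset.sum_eq_zero_iff.mp hx) i (Finset.mem_univ i)
      exact Int.natAbs_eq_zero.mp this
    rwa [this] at h0
  | succ n ih =>
    intro x hx h0
    have hΔ : 0 ≤ latticeLaplacianZd (fun z => -latticeGreen z) x := by
      have h1 : (fun z : Site d => -latticeGreen z) = fun z => (-1 : ℝ) * latticeGreen z := by
        funext z; ring
      rw [h1, latticeLaplacianZd_const_mul, latticeLaplacianZd_latticeGreen d hd x]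
      split_ifs <;> norm_num
    have hmv := fun i => eq_of_latticeLaplacianZd_nonneg (H := fun z => -latticeGreen z) (M := 0) hΔ
      (by simp [h0]) (fun j => by simp [hG]) (fun j => by simp [hG]) i
    have hne : ∃ i, x i ≠ 0 := by
      by_contra hall
      push Not at hall
      have : ∑ i, (x i).natAbs = 0 := Finset.sum_eq_zero fun i _ => by simp [hall i]
      omega
    obtain ⟨i, hi⟩ := hne
    -- splitting the `ℓ¹` norm at the coordinate `i`
    have hsplit : ∀ z : Site d, ∑ j, (z j).natAbs = (z i).natAbs + ∑ j ∈ univ.erase i, (z j).natAbs :=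
      fun z => (Finset.add_sum_erase _ _ (Finset.mem_univ i)).symm
    have hoff : ∀ s : ℤ, ∑ j ∈ univ.erase i, ((x + (Pi.single i s : Site d)) j).natAbs = ∑ j ∈ univ.erase i, (x j).natAbs :=
      fun s => Finset.sum_congr rfl fun j hj => by
        rw [Pi.add_apply, Pi.single_apply, if_neg (Finset.ne_of_mem_erase hj), add_zero]
    rw [hsplit] at hx
    rcases lt_or_gt_of_ne hi with hneg | hpos
    · refine ih (x + Pi.single i 1) ?_ (by have := (hmv i).1; simpa using this)
      rw [hsplit, hoff 1, Pi.add_apply, Pi.single_eq_same]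
      omega
    · refine ih (x - Pi.single i 1) ?_ (by have := (hmv i).2; simpa using this)
      rw [sub_eq_add_neg, ← Pi.single_neg, hsplit, hoff (-1), Pi.add_apply, Pi.single_eq_same]
      omega

variable (d) in
/-- **The lattice Green function of `ℤ^d` is strictly positive** (`d ≥ 3`): `0 < latticeGreen x` for every `x`.
(If `latticeGreen x = 0` then `latticeGreen 0 = 0` by `latticeGreen_eq_zero_propagate`, and then the Poisson identity
`Δ latticeGreen (0) = -2` reads `∑ᵢ (latticeGreen eᵢ + latticeGreen (-eᵢ)) = -2 < 0`, contradicting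
`latticeGreen ≥ 0`.)  In random-walk terms: the simple random walk on `ℤ^d` is irreducible. [cite: Lawler1991, §1.5] -/
theorem latticeGreen_pos (hd : 3 ≤ d) (x : Site d) : 0 < latticeGreen x := by
  have hG := fun z => latticeGreen_nonneg d hd z
  rcases (hG x).lt_or_eq with h | h
  · exact h
  · exfalso
    have h0 := latticeGreen_eq_zero_propagate d hd _ x rfl h.symm
    have hP := latticeLaplacianZd_latticeGreen_zero d hd
    rw [latticeLaplacianZd_def, h0] at hP
    have : 0 ≤ ∑ i : Fin d, (latticeGreen ((0 : Site d) + Pi.single i 1) +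
        latticeGreen ((0 : Site d) - Pi.single i 1)) :=
      Finset.sum_nonneg fun i _ => add_nonneg (hG _) (hG _)
    linarith

variable (d) in
/-- `latticeGreen 0 > 0` (`d ≥ 3`); indeed `latticeGreen 0 ≥ 1/d` from `Δ latticeGreen (0) = -2`. [cite: Lawler1991, §1.5] -/
theorem one_div_le_latticeGreen_zero (hd : 3 ≤ d) : 1 / (d : ℝ) ≤ latticeGreen (0 : Site d) := by
  have hG := fun z => latticeGreen_nonneg d hd z
  have hP := latticeLaplacianZd_latticeGreen_zero d hd
  rw [latticeLaplacianZd_def] at hP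
  have hs : 0 ≤ ∑ i : Fin d, (latticeGreen ((0 : Site d) + Pi.single i 1) +
      latticeGreen ((0 : Site d) - Pi.single i 1)) :=
    Finset.sum_nonneg fun i _ => add_nonneg (hG _) (hG _)
  have hd0 : (0 : ℝ) < d := by
    have : (3 : ℝ) ≤ d := by exact_mod_cast hd
    linarith
  rw [div_le_iff₀ hd0]
  nlinarith

end Literature.Probability.LatticeModels
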